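import Summits.HodgeConjecture.HodgeConjecture.Cruxes.BlochSeedDiscOne.RBDoorChainSheafCruxRescale
import Summits.HodgeConjecture.HodgeConjecture.Cruxes.BlochSeedDiscOne.SeedCheckerSplitBlockCFree
import Summits.HodgeConjecture.HodgeConjecture.Cruxes.BlochSeedDiscOne.SheafDoorWindowBudget
import Summits.HodgeConjecture.HodgeConjecture.Cruxes.BlochSeedDiscOne.RowAlpha1RuleDSharp
import Summits.HodgeConjecture.HodgeConjecture.Cruxes.BlochSeedDiscOne.KunnethNoInterference
import HarnessLib

/-!
# Line `sheafdoor` — skeleton (CRUX-PLAN) of the crux `SheafSeedGaussSq`, route № 3′ `EightfoldTwistedSheafSeeds` (stmt-HodgeConjecture-30548)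

Fuse (C) of director-hodge req-195 as amended by req-201 (C′) ∕ hsem R19.862 (C′); c5c8 memo SEED-CHECKER-C5C8 §3 (v42.1).

THE LINE («door S», Buchweitz–Flenner single-sheaf disjunct `bfSingleAdmissible'` of the crux's admissibility notion).  On the CM anchor
`S⁴ = pad4Anchor E₀` (`E₀` an elliptic curve with `ψ₀² = −1`) take a SPLIT BLOCK `0 → 𝓟 → 𝓝 → 𝓔 → 0` whose two left terms are direct sums of the
letter line bundles of a POSITIVE shell design at height `14` (v41 `SplitBlock.SplitBlockCore`), and ask that its cokernel `𝓔` pass the RANK-FREE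
sheaf-seed checker in the Hodge window `I₀ = {4}` (`σ₃ : Ext²(𝓔,𝓔) → H⁵(Ω³)` injective — the strongest single window, re-windowed to `{1,…,8}` for
free by `IsISemiregular.mono`) with its shell shadow in READING-1 scope.  Every Chern character theory `C` reads the block UP TO THE RESCALING
`chᵢ ↦ tⁱ·chᵢ` (hazard (f5′): a fixed-scale `∀ C` stub is RETIRED by R19.862 (C′)); the transfer to the crux is the tree's covariance THEOREM
`RBDoorChainSheafCrux.hasHyperbolicBFSheafSeedOn_rescale_iff`, so there is NO `stub_transfer`.

REGISTERED STUBS (three `theorem stub_* := by sorry`; nothing else in this file contains `sorry`):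
* `stub_rung2aSheaf` — ON PATH, the stub of record under the v42.1 NAME (R19.862 (C′) ∕ R19.871): `SplitBlock.Rung2aSheafUpToScale {4} 14`
  (= `∀ C, ∃ t ≠ 0, SplitBlock.Rung2aSheaf₀ (C.rescale t ht) {4} 14`, `stub_rung2aSheaf_iff`, `Iff.rfl`).  Size XL.
* `stub_rung2bSheaf` — KILL PATH, row 8 in the instance OF RECORD (8σ) `(σ, π) := (SigmaH.sigmaH, 3136 − windowBudget {4})` UNDER the named
  per-core law `KunnethNoInterference` (R19.847 (2) ∕ R19.862 (A3′): a hypothesis wherever used, may fail in the legged room): the scope-guarded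
  sheaf 2b `SplitBlock.Rung2bSheaf₀Under` with rows `SplitBlock.ShadowRows₀ RowAlpha1.RuleDSharp SplitBlock.lawPP sigmaH π`.  Size M–L.
* `stub_rung2bSheaf_phi` — KILL PATH, the LAW-FREE companion (8♮) `(σ, π) := (KunnethNoInterference.phiAllPlus, 3136 − windowBudget {4})`
  (LEMMA Δ decoration-free floor, pen): `SplitBlock.Rung2bSheaf₀With` with the same rows.  Size M–L.
`3136 − windowBudget {4} = 0` (`SheafDoorWindowBudget.windowBudget_four`; `pi_four_eq_zero` below): the (s2) re-pricing of the budget row for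
the window `{4}` is the clause of record `BudgetClause σ 0` (`SheafDoorWindowBudget.budgetClauseW_four_iff`).

ON PATH (sorry only through `stub_rung2aSheaf`): `SheafSeedGaussSq_of` = `RBDoorChainSheafCrux.sheafSeedGaussSq_of_rung2aSheaf_four_upToScale`
∘ `SplitBlock.rung2aSheaf_of_rung2aSheaf₀` (under the binders: `rung2aSheaf_rescale_of_upToScale_four`) ∘ `stub_rung2aSheaf`, concluding the crux BY NAME with
`m := 2` — the in-tree leaves only; c5c8 v42.2's packaged one-liner `sheafSeedGaussSq_of_rung2aSheafUpToScale_four` (bridge `SeedCheckerSplitBlockSheafBridge.lean`,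
staged beb67042b20e2755) is the same term once importable.  ONE genuine on-path stub: the
seat found no honest second ON-PATH stub (the CM anchor's existence is a theorem, `Anchor.exists_cmCurve_sqrt_neg`; a «C-free geometry ∕ uniform
reading» split is not typable honestly because the C-free letter kit `LetterKit₀` does not pin its letters to their cells) and says so rather than
shred (BC3 floor: director to rule, R19.862 (C′)).

KILL PATH (sorry-free, hypothesis-carrying; the 2b stubs enter AS STATEMENTS, the closed room `SplitBlock.SPlus₀ …` is a HYPOTHESIS — shells 1–2
closed, shells 3–4 OPEN, R19.853; № 3's closed shells were priced at the σ₃-only budget `({4}, π = 0)` of line #2's sieve and DO NOT transfer to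
this door unpriced): `not_rung2aSheaf₀_rescale_of_sPlus₀` (law-free rows closed ⟹ no rescaled theory passes), `not_stub_rung2aSheaf_of_sPlus₀`
(… ⟹ `¬ SplitBlock.Rung2aSheafUpToScale {4} 14` = ¬ STUB 1 in the SAME currency, GIVEN ONE THEORY `(C₀ : ChernCharacterBetti)` — the binder IS
item 19780, named as a hypothesis, never assumed or constructed here; Disproof.lean §C `sheafSeedGaussSq_of_isEmpty`: with no theory the crux and the
stub hold vacuously), `not_stub_rung2aSheaf_of_sPlus₀_phi` (the (8♮) kill of record, law-free), `no_kni_core_of_sPlus₀_sigmaH` (the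
honest law-restricted (8σ) kill: no KNI-abiding honest core), `not_rung2aSheaf₀_rescale_of_sPlus₀_under` (the (8σ) kill of the stub needs the
law on EVERY core — flagged: false in general per `KunnethNoInterference`'s docstring §B (c); the decoration-free kill is (8♮)).

DISPROOF USED (Cruxes/SheafSeedGaussSq/Disproof.lean v4.2): no `_false_without_` theorem exists for this crux; §C (vacuity off `Nonempty`) is
honoured by the explicit `Nonempty ChernCharacterBetti` hypothesis of every `¬ stub` theorem; §G (R-ii) (the `∀ C` torsor ∕ rescaling) is honoured
by the up-to-scale shape; §D (Euler squeeze) and NOGO-n4 concern σ-semiregular SECANT objects on abelian FOURFOLDS (the gluable disjunct) — this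
line's object is an `I`-semiregular vector bundle on the EIGHTFOLD through the BF disjunct, outside their quantifiers; no landed Negative lemma
concerns split-block cokernels.

HONEST REGISTER.  Planning ∕ bookkeeping only: three sorried stubs, one composition, kill-path tautologies.  Nothing here proves anything toward
the Hodge conjecture; `SheafSeedGaussSq` is NOT proved; HC is NOT proved.
-/

set_option linter.dupNamespace false
set_option autoImplicit false

namespace Summit.HodgeConjecture.HodgeConjecture.Cruxes.SheafSeedGaussSq.SheafDoor

open CategoryTheory AlgebraicGeometry
open Literature.AlgebraicGeometry Literature.AlgebraicGeometry.Motives Literature.AlgebraicGeometry.HodgeTheory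
open Summit.HodgeConjecture.HodgeConjecture.Cruxes.BlochSeedDiscOne
open Summit.HodgeConjecture.HodgeConjecture.Cruxes.BlochSeedDiscOne.SeedChecker
open Summit.HodgeConjecture.HodgeConjecture.Cruxes.BlochSeedDiscOne.SeedChecker.SplitBlock

/-! ## §1 Registered stubs (signatures spelled over importable declarations — SKELETON-IMPORT HYGIENE) -/

section Stubs

/-- **STUB 1 — `stub_rung2aSheaf`, RUNG 2a OF DOOR S, UP TO SCALE (ON PATH; the stub of record under the v42.1 NAME, R19.862 (C′) ∕ R19.871;
size XL).**  `SplitBlock.Rung2aSheafUpToScale {4} 14`, i.e. (`stub_rung2aSheaf_iff`, `Iff.rfl`) `∀ C, ∃ (t : ℚ) (ht : t ≠ 0), SplitBlock.Rung2aSheaf₀ (C.rescale t ht) {4} 14`: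
for every Chern character theory `C` there is a rescaling `t ∈ ℚˣ` such that ON SOME CM anchor `(E₀, ψ₀)` (`dim E₀ = 1`, `ψ₀² = −1`) a v41 split-block core
`δ : SplitBlock.SplitBlockCore (C.rescale t ht) E₀ ψ₀` — anchor kit, linked word frame, shell design `δ.Dsh`, block `0 → 𝓟 → 𝓝 → 𝓔 → 0` with `𝓟`, `𝓝` split into
the letter line bundles — has (i) POSITIVE shell design (`δ.Dsh.Positive`, MEMO-177 F7), (ii) a cokernel `𝓔 = δ.S.X₃` passing the rank-free sheaf-seed checker
in the window `{4}` (`δ.PassesSheaf {4} := δ.Dsh.SheafSeedCheckRankFree (C.rescale t ht) {4} δ.K δ.S.X₃`: clean rank-free class data, `4 ∈ {4} ⊆ {0..8}`,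
`𝓔` finite locally free and `{4}`-semiregular — `σ₃ : Ext²(𝓔,𝓔) → H⁵(Ω³)` injective, Buchweitz–Flenner — and `RealisedBy`: the twisted Chern character of `𝓔` read
THROUGH the theory is the design's), (iii) shell shadow in READING-1 scope at height `14` (`ScopeRows 14 δ.Dsh.shadow`: `OnAlphabet 14 ∧ Disj`).
PRESENTATION-TIED, costume declared (officer AUDIT 123 ∕ AUDIT 125 S1–S7, hsem l.13551 ∕ l.13561; director R19.864 (C″) ∕ R19.866 (C‴), binding): read through `_of`,
`Rung2aSheaf C I h` says ‹on some CM anchor some in-scope split-block presentation `0 → ⊕L_P^{m_P} → ⊕L_N^{m_N} → 𝓔 → 0` has an `I`-SEMIREGULAR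
finite-locally-free COKERNEL `𝓔` whose Chern character through `C` is the clean rank-free design's› — the door certifies the presentation's OWN cokernel `S.X₃` (no
free sheaf, no inner `∃ sheaf`), the class clause is structural (exactness, law-free), the semiregularity of that named sheaf is the whole difficulty; this is
`HasHyperbolicBFSheafSeedOn C 4 1 I` at an anchor PLUS the presentation, hence stronger than 30548-at-an-anchor, and the kill half (guarded 2b rows on `Dsh.shadow`,
`SPlus₀` a hypothesis, shells 3–4 OPEN) refutes PRESENTATIONS only — never `¬ SheafSeedGaussSq`.  HOW `C` ENTERS (c5c8-1 g55 RESULT-1, R19.871): on the C-free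
core `C` enters `PassesSheaf` ONLY via `SplitBlockCore₀.PassesSheafVia C hR I := (δ.toSplitBlockCore C hR).PassesSheaf I`, `hR : δ.LettersRealise C` (v42.1 §42.2) — door S
reads `ch` THROUGH a theory by construction, hence `∀ C ∃ t`, not C-free as on the lci door; the fixed-scale `∀ C, Rung2aSheaf C {4} 14` is RETIRED (hazard (f5′)).
WHY IT MIGHT FAIL: no candidate block is known to pass — line bundles have `w = 0`, split bundles are dead (card monomial-design-seed §2), `B136`'s shadow violates every
honest budget (`KunnethNoInterference.not_budgetClause_phiAllPlus_B136`), and a closed v42 room in the currency (8♮) refutes the stub outright given one theory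
(`not_stub_rung2aSheaf_of_sPlus₀_phi`). [cite: BuchweitzFlenner2003, Thm. 5.2, §5] [cite: Bloch1972Semiregularity, Thm. (7.4)] [cite: Pridham2024Semiregularity, Cor. 2.25] -/
theorem stub_rung2aSheaf : SplitBlock.Rung2aSheafUpToScale {4} 14 := by
  sorry

/-- **STUB 2 — `stub_rung2bSheaf`, RUNG 2b OF DOOR S, SCOPE-GUARDED, ROW 8 IN THE INSTANCE OF RECORD (8σ) UNDER THE LAW (KILL PATH; size M–L).**
For every theory `C`, on every CM anchor, every v41 split-block core through `C` that ABIDES THE PER-CORE LAW `KunnethNoInterference` on its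
(shell shadow, cokernel) (`sigmaH (δ.Dsh.shadow) ≤ dim Ext²(𝓔,𝓔)`; R19.847 (2): a hypothesis, discharged where the six separated vanishings hold,
possibly false in the legged room), has POSITIVE shell, PASSES the sheaf door at `{4}` and has its shadow IN SCOPE at height `14`, has a shadow
`D' = δ.Dsh.shadow` passing the v42 SHADOW ROWS with `α1 := RowAlpha1.RuleDSharp` (span condition, pen-derived exact first-order form of door
(H2), cokernel orientation), `PP := SplitBlock.lawPP`, budget functional `SigmaH.sigmaH` and rider `π := 3136 − windowBudget {4}` (`= 0`):
`A1 ∧ μ ≠ 0 ∧ RuleDSharp ∧ HallUp ∧ lawPP ∧ HallPlusLegUp ∧ 4 ≤ rank ∧ σ_H + 28·(rank − 4) + π ≤ 3136`, each row to be DERIVED as a necessary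
condition of honesty + door pass.  WHY IT MIGHT FAIL: a passing honest core whose shadow violates the leg row (FLAGGED R19.859: theorem-grade
only on uniform-leg ∕ leg-free-star column sets) or `RuleDSharp` (the span condition is derived for the lci door's `T_W`-blocks; its transfer to
the sheaf door's block map is pen) — then that ROW dies, not the line. [cite: BuchweitzFlenner2003, Thm. 5.2] [cite: Fulton1998, §14.4] -/
theorem stub_rung2bSheaf :
    ∀ C : ChernCharacterBetti,
      SplitBlock.Rung2bSheaf₀Under C
        (fun (E₀ : AbelianVariety ℂ) (ψ₀ : E₀ ⟶ E₀) (δ : SplitBlock.SplitBlockCore C E₀ ψ₀) =>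
          KunnethNoInterference.KunnethNoInterference δ.Dsh.shadow δ.S.X₃)
        {4} 14
        (SplitBlock.ShadowRows₀ RowAlpha1.RuleDSharp SplitBlock.lawPP SigmaH.sigmaH
          ((3136 : ℤ) - (SheafDoorWindowBudget.windowBudget {4} : ℤ))) := by
  sorry

/-- **STUB 3 — `stub_rung2bSheaf_phi`, RUNG 2b OF DOOR S, SCOPE-GUARDED, LAW-FREE COMPANION (8♮) (KILL PATH; size M–L).**  As STUB 2 but for
EVERY core (law `CoreLaw.trivial`, i.e. `SplitBlock.Rung2bSheaf₀With`) and with the DECORATION-FREE budget functional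
`KunnethNoInterference.phiAllPlus` (LEMMA Δ: `Φ⁺_all(D') ≤ dim Ext²(𝓔,𝓔)` for every Pic⁰ decoration and every injective block map — pen ×2, the
floor law `PhiAllPlusFloor`), same `α1 := RuleDSharp`, `PP := lawPP`, rider `3136 − windowBudget {4} = 0`.  The currency in which a closed room
kills the on-path stub WITHOUT any law (`not_stub_rung2aSheaf_of_sPlus₀`); `B136` already fails this budget for every `π ≥ 0`
(`KunnethNoInterference.not_budgetClause_phiAllPlus_B136`).  WHY IT MIGHT FAIL: as STUB 2 (leg row, `RuleDSharp` transfer), plus the floor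
`PhiAllPlusFloor` itself is pen, not kernel. [cite: BuchweitzFlenner2003, Thm. 5.2] [cite: Mukai1981FourierAV, §2] -/
theorem stub_rung2bSheaf_phi :
    ∀ C : ChernCharacterBetti,
      SplitBlock.Rung2bSheaf₀With C {4} 14
        (SplitBlock.ShadowRows₀ RowAlpha1.RuleDSharp SplitBlock.lawPP KunnethNoInterference.phiAllPlus
          ((3136 : ℤ) - (SheafDoorWindowBudget.windowBudget {4} : ℤ))) := by
  sorry

end Stubs

/-! ## §2 The composition — STUB 1 ⟹ the crux BY NAME (no `sorry` below this line) -/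

section CruxPath

/-- the on-path stub's statement, unfolded (v42.1 `SplitBlock.Rung2aSheafUpToScale`). [`Iff.rfl`] -/
theorem stub_rung2aSheaf_iff :
    SplitBlock.Rung2aSheafUpToScale {4} 14 ↔
      ∀ C : ChernCharacterBetti, ∃ (t : ℚ) (ht : t ≠ 0), SplitBlock.Rung2aSheaf₀ (C.rescale t ht) {4} 14 :=
  Iff.rfl

/-- the v42.1 name gives the v41 shape named in R19.862 (C′) (`SplitBlock.Rung2aSheaf`, positivity forgotten under the binders by
`SplitBlock.rung2aSheaf_of_rung2aSheaf₀`; = c5c8 v42.2's `rung2aSheaf_upToScale_of_rung2aSheafUpToScale` at `({4}, 14)`, proved here so that this file needs only the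
in-tree leaves) — hypothesis-carrying, sorry-free. -/
theorem rung2aSheaf_rescale_of_upToScale_four (h : SplitBlock.Rung2aSheafUpToScale {4} 14) :
    ∀ C : ChernCharacterBetti, ∃ (t : ℚ) (ht : t ≠ 0), SplitBlock.Rung2aSheaf (C.rescale t ht) {4} 14 := fun C => by
  obtain ⟨t, ht, h2⟩ := h C
  exact ⟨t, ht, rung2aSheaf_of_rung2aSheaf₀ h2⟩

/-- **THE SKELETON THEOREM `SheafSeedGaussSq_of` — STUB 1 ⟹ the crux BY NAME** (hypothesis-free; the registered stub is used by name; the ONLY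
declaration of this file whose conclusion is `…Theses.EightfoldTwistedSheafSeeds.SheafSeedGaussSq`).  Route: `Rung2aSheafUpToScale {4} 14` ⟹ v41 sheaf rung for
`C.rescale t` (`rung2aSheaf_rescale_of_upToScale_four`) ⟹ BF sheaf seed at level `(4, 1)` in the window `{1,…,8}` for `C.rescale t`
(`hasHyperbolicBFSheafSeedOn_icc_of_rung2aSheaf`, re-windowing free) ⟹ the same for `C` (covariance THEOREM `hasHyperbolicBFSheafSeedOn_rescale_iff`) ⟹ the crux
with `m := 2` (`sheafSeedGaussSq_of_hyperbolicBFSheafSeedsOn`), packaged by sheaf8 as `RBDoorChainSheafCrux.sheafSeedGaussSq_of_rung2aSheaf_four_upToScale` (PLATE #96,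
12∕12 std axioms).  Equal to c5c8 v42.2's one-liner `sheafSeedGaussSq_of_rung2aSheafUpToScale_four stub_rung2aSheaf` once that bridge module is importable.
No `sorry` in this declaration; `sorryAx` enters its axiom closure only through `stub_rung2aSheaf`. -/
theorem SheafSeedGaussSq_of : Summit.HodgeConjecture.HodgeConjecture.Theses.EightfoldTwistedSheafSeeds.SheafSeedGaussSq :=
  RBDoorChainSheafCrux.sheafSeedGaussSq_of_rung2aSheaf_four_upToScale (rung2aSheaf_rescale_of_upToScale_four stub_rung2aSheaf)

end CruxPath

/-! ## §3 The rider of the window `{4}` -/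

section Rider

/-- `3136 − windowBudget {4} = 0`: for the window `{4}` the (s2) re-priced budget row is the clause of record `BudgetClause σ 0`. -/
theorem pi_four_eq_zero : (3136 : ℤ) - (SheafDoorWindowBudget.windowBudget {4} : ℤ) = 0 := by
  rw [SheafDoorWindowBudget.windowBudget_four]
  norm_num

/-- STUB 2's statement in the `π = 0` normal form. -/
theorem stub_rung2bSheaf_iff_pi_zero :
    (∀ C : ChernCharacterBetti,
      SplitBlock.Rung2bSheaf₀Under C
        (fun (E₀ : AbelianVariety ℂ) (ψ₀ : E₀ ⟶ E₀) (δ : SplitBlock.SplitBlockCore C E₀ ψ₀) =>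
          KunnethNoInterference.KunnethNoInterference δ.Dsh.shadow δ.S.X₃)
        {4} 14
        (SplitBlock.ShadowRows₀ RowAlpha1.RuleDSharp SplitBlock.lawPP SigmaH.sigmaH
          ((3136 : ℤ) - (SheafDoorWindowBudget.windowBudget {4} : ℤ)))) ↔
    (∀ C : ChernCharacterBetti,
      SplitBlock.Rung2bSheaf₀Under C
        (fun (E₀ : AbelianVariety ℂ) (ψ₀ : E₀ ⟶ E₀) (δ : SplitBlock.SplitBlockCore C E₀ ψ₀) =>
          KunnethNoInterference.KunnethNoInterference δ.Dsh.shadow δ.S.X₃)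
        {4} 14 (SplitBlock.ShadowRows₀ RowAlpha1.RuleDSharp SplitBlock.lawPP SigmaH.sigmaH 0)) := by
  rw [pi_four_eq_zero]

/-- STUB 3's statement in the `π = 0` normal form. -/
theorem stub_rung2bSheaf_phi_iff_pi_zero :
    (∀ C : ChernCharacterBetti,
      SplitBlock.Rung2bSheaf₀With C {4} 14
        (SplitBlock.ShadowRows₀ RowAlpha1.RuleDSharp SplitBlock.lawPP KunnethNoInterference.phiAllPlus
          ((3136 : ℤ) - (SheafDoorWindowBudget.windowBudget {4} : ℤ)))) ↔
    (∀ C : ChernCharacterBetti,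
      SplitBlock.Rung2bSheaf₀With C {4} 14
        (SplitBlock.ShadowRows₀ RowAlpha1.RuleDSharp SplitBlock.lawPP KunnethNoInterference.phiAllPlus 0)) := by
  rw [pi_four_eq_zero]

end Rider

/-! ## §4 The kill path (sorry-free, hypothesis-carrying): 2b + a CLOSED v42 room ⟹ ¬ 2a -/

section KillPath

/-- **LAW-FREE KILL, generic rows**: law-free scope-guarded sheaf 2b for every theory with rows `ShadowRows₀ RD PP σ π`, and the v42 room
`SPlus₀ RD PP 14 σ π` CLOSED (hypothesis) ⟹ NO rescaling of ANY theory passes the positive sheaf rung at `({4}, 14)`.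
[`SplitBlock.not_rung2aSheaf₀_of_sPlus₀` at `C.rescale t ht`] -/
theorem not_rung2aSheaf₀_rescale_of_sPlus₀ {RD PP : DepthBoundA4.Design → Prop} {σ : DepthBoundA4.Design → ℤ} {π : ℤ}
    (h2b : ∀ C : ChernCharacterBetti, SplitBlock.Rung2bSheaf₀With C {4} 14 (SplitBlock.ShadowRows₀ RD PP σ π))
    (hS : SplitBlock.SPlus₀ RD PP 14 σ π) :
    ∀ (C : ChernCharacterBetti) (t : ℚ) (ht : t ≠ 0), ¬ SplitBlock.Rung2aSheaf₀ (C.rescale t ht) {4} 14 :=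
  fun C t ht => not_rung2aSheaf₀_of_sPlus₀ (h2b (C.rescale t ht)) hS

/-- **… hence ¬ STUB 1 (same currency), GIVEN ONE THEORY `C₀`** — the binding closing-lemma shape (R19.871; = c5c8 v42.2
`SplitBlock.not_rung2aSheafUpToScale_of_sPlus₀`, bridge module staged∕landing): the negation of a `∀ C` stub needs ONE theory `C₀`, and that binder IS item 19780
(`Ring2.SemiregularRepresentatives.ChernCharacterOnBetti`), NAMED here as a hypothesis of the kill lemma, never assumed, never constructed; over an EMPTY
`ChernCharacterBetti` both the stub and `SheafSeedGaussSq` are vacuous (the standing 19780 caveat; Disproof.lean §C `sheafSeedGaussSq_of_isEmpty`; v42.2's window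
guard `not_rung2aSheafUpToScale_empty` likewise needs `C₀`).  A closed room retires PRESENTATIONS, never `¬ SheafSeedGaussSq` (AUDIT 125 (d)). -/
theorem not_stub_rung2aSheaf_of_sPlus₀ (C₀ : ChernCharacterBetti) {RD PP : DepthBoundA4.Design → Prop}
    {σ : DepthBoundA4.Design → ℤ} {π : ℤ}
    (h2b : ∀ C : ChernCharacterBetti, SplitBlock.Rung2bSheaf₀With C {4} 14 (SplitBlock.ShadowRows₀ RD PP σ π))
    (hS : SplitBlock.SPlus₀ RD PP 14 σ π) : ¬ SplitBlock.Rung2aSheafUpToScale {4} 14 := by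
  intro h
  obtain ⟨t, ht, h2⟩ := h C₀
  exact not_rung2aSheaf₀_rescale_of_sPlus₀ h2b hS C₀ t ht h2

/-- the same with the witness as `Nonempty ChernCharacterBetti` (the form item 19780 delivers). -/
theorem not_stub_rung2aSheaf_of_sPlus₀_nonempty (hC : Nonempty ChernCharacterBetti) {RD PP : DepthBoundA4.Design → Prop}
    {σ : DepthBoundA4.Design → ℤ} {π : ℤ}
    (h2b : ∀ C : ChernCharacterBetti, SplitBlock.Rung2bSheaf₀With C {4} 14 (SplitBlock.ShadowRows₀ RD PP σ π))
    (hS : SplitBlock.SPlus₀ RD PP 14 σ π) : ¬ SplitBlock.Rung2aSheafUpToScale {4} 14 := by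
  obtain ⟨C₀⟩ := hC
  exact not_stub_rung2aSheaf_of_sPlus₀ C₀ h2b hS

/-- **THE (8♮) KILL OF RECORD** — STUB 3's statement verbatim + the v42 room closed in the currency `(RuleDSharp, lawPP; phiAllPlus, 0)` + ONE
theory `C₀` (item 19780) ⟹ ¬ STUB 1.  (The closure is OPEN: shells 1–2 closed, 3–4 open, R19.853 — and those closures were priced at the σ₃-only
budget `({4}, π = 0)` in line #2's currency `(RuleD; sigmaH, 0)`, NOT this one: they do not transfer unpriced.) -/
theorem not_stub_rung2aSheaf_of_sPlus₀_phi (C₀ : ChernCharacterBetti)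
    (h2b : ∀ C : ChernCharacterBetti,
      SplitBlock.Rung2bSheaf₀With C {4} 14
        (SplitBlock.ShadowRows₀ RowAlpha1.RuleDSharp SplitBlock.lawPP KunnethNoInterference.phiAllPlus
          ((3136 : ℤ) - (SheafDoorWindowBudget.windowBudget {4} : ℤ))))
    (hS : SplitBlock.SPlus₀ RowAlpha1.RuleDSharp SplitBlock.lawPP 14 KunnethNoInterference.phiAllPlus 0) :
    ¬ SplitBlock.Rung2aSheafUpToScale {4} 14 :=
  not_stub_rung2aSheaf_of_sPlus₀ C₀ (stub_rung2bSheaf_phi_iff_pi_zero.mp h2b) hS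

/-- **THE HONEST (8σ) KILL, LAW-RESTRICTED**: STUB 2's statement (generic rider) + the v42 room closed in the currency `(RuleDSharp, lawPP;
sigmaH, π)` ⟹ on no CM anchor does a `KunnethNoInterference`-ABIDING positive core pass the sheaf door at `{4}` with shadow in scope.  Cores
violating the law are untouched (they are the (8♮) kill's business). [unfolding] -/
theorem no_kni_core_of_sPlus₀_sigmaH {π : ℤ}
    (h2b : ∀ C : ChernCharacterBetti,
      SplitBlock.Rung2bSheaf₀Under C
        (fun (E₀ : AbelianVariety ℂ) (ψ₀ : E₀ ⟶ E₀) (δ : SplitBlock.SplitBlockCore C E₀ ψ₀) =>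
          KunnethNoInterference.KunnethNoInterference δ.Dsh.shadow δ.S.X₃)
        {4} 14 (SplitBlock.ShadowRows₀ RowAlpha1.RuleDSharp SplitBlock.lawPP SigmaH.sigmaH π))
    (hS : SplitBlock.SPlus₀ RowAlpha1.RuleDSharp SplitBlock.lawPP 14 SigmaH.sigmaH π)
    (C : ChernCharacterBetti) (E₀ : AbelianVariety ℂ) (ψ₀ : E₀ ⟶ E₀) (hE : E₀.dim = 1) (hψ : ψ₀ ≫ ψ₀ = -(1 • 𝟙 E₀))
    (δ : SplitBlock.SplitBlockCore C E₀ ψ₀) (hk : KunnethNoInterference.KunnethNoInterference δ.Dsh.shadow δ.S.X₃)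
    (hpos : δ.Dsh.Positive) (hδ : δ.PassesSheaf {4}) (hscope : ScopeRows 14 δ.Dsh.shadow) : False :=
  hS δ.Dsh.shadow ⟨hscope, h2b C E₀ ψ₀ hE hψ δ hk hpos hδ hscope⟩

/-- **THE (8σ) KILL OF THE STUB NEEDS THE LAW EVERYWHERE** (FLAGGED: `KunnethNoInterference` on EVERY core is FALSE in general — docstring §B (c)
of `KunnethNoInterference.lean`; this theorem only records what the law-restricted currency would buy if the law were global): law-guarded 2b +
the law on all cores + the room closed ⟹ no rescaled theory passes. [`SplitBlock.not_rung2aSheaf₀_of_rung2bSheaf₀Under`] -/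
theorem not_rung2aSheaf₀_rescale_of_sPlus₀_under {Λ : ∀ C : ChernCharacterBetti, SplitBlock.CoreLaw C}
    (hΛ : ∀ (C : ChernCharacterBetti) (E₀ : AbelianVariety ℂ) (ψ₀ : E₀ ⟶ E₀) (δ : SplitBlock.SplitBlockCore C E₀ ψ₀), Λ C E₀ ψ₀ δ)
    {RD PP : DepthBoundA4.Design → Prop} {σ : DepthBoundA4.Design → ℤ} {π : ℤ}
    (h2b : ∀ C : ChernCharacterBetti, SplitBlock.Rung2bSheaf₀Under C (Λ C) {4} 14 (SplitBlock.ShadowRows₀ RD PP σ π))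
    (hS : SplitBlock.SPlus₀ RD PP 14 σ π) :
    ∀ (C : ChernCharacterBetti) (t : ℚ) (ht : t ≠ 0), ¬ SplitBlock.Rung2aSheaf₀ (C.rescale t ht) {4} 14 :=
  fun C t ht => not_rung2aSheaf₀_of_rung2bSheaf₀Under (hΛ (C.rescale t ht)) (h2b (C.rescale t ht)) fun D' hscope hrows => hS D' ⟨hscope, hrows⟩

/-- law-free 2b is 2b under any law (the law only adds an antecedent): STUB 3's rows-statement gives the `Rung2bSheaf₀Under Λ` form for every `Λ`. -/
theorem rung2bSheaf₀Under_of_with {C : ChernCharacterBetti} (Λ : SplitBlock.CoreLaw C) {I : Finset ℕ} {h : ℤ}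
    {Rows : DepthBoundA4.Design → Prop} (h2b : SplitBlock.Rung2bSheaf₀With C I h Rows) : SplitBlock.Rung2bSheaf₀Under C Λ I h Rows :=
  fun E₀ ψ₀ hE hψ δ _ hpos hδ hscope => h2b E₀ ψ₀ hE hψ δ trivial hpos hδ hscope

end KillPath

/-! ## Audit: nothing is decided here -/

/-- Three sorried stubs; `SheafSeedGaussSq_of` is sorry-free but its axiom closure contains `sorryAx` through `stub_rung2aSheaf` until that stub
is proved; §3–§4 are tautologies of the v42.1 vocabulary.  `SheafSeedGaussSq` is NOT proved; the Hodge conjecture is NOT proved. -/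
theorem audit_nothing_decided : True := trivial

end Summit.HodgeConjecture.HodgeConjecture.Cruxes.SheafSeedGaussSq.SheafDoor
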